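import Summits.ResolutionOfSingularities.ResolutionOfSingularities.Theorems.WildConesCampaignW46ForcedAtomExists
import Summits.ResolutionOfSingularities.ResolutionOfSingularities.Theorems.MarkedTransferCampaignW46PermissibleReduction
import HarnessLib

/-!
# [OURS · L1 W4.6, rung (i)/(all `n ≥ 1`) — RÉSUMÉ-FREE FORM] Every §2.1-PERMISSIBLE SEQUENCE of blow-ups all of whose
# stages lie in the forced-atom regime is FINITE: `CampaignW46.PermissiblyTerminates (Regime.forcedAtom n)` over every
# algebraically closed field of characteristic `p`
# (cell res-hironaka, LADDER-RESOLUTION rung L, D-0089; slot W4.6, seat res-L1-s46-pv-2 gen 3; host route `WildCones`,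
# crux `ClassicalRegimes` stmt-ResolutionOfSingularities-16884, `--supports … --as helper`)

HONEST FRAMING. Everything here is OURS. NOTHING below is a statement of H. Hironaka's manuscript [Hironaka2017] and
nothing asserts that any statement of it holds: res-L1-s46-pv-1's résumé-free vocabulary (`CampaignW46.PermissibleRun`,
`PermissiblyTerminates`, `Theorems/MarkedTransferCampaignW46PermissibleReduction.lean`), res-L1-type-o1's regime
`Regime.forcedAtom` (p517839) and the typed candidate carriers of row 001 (`AmbientDatum`, `IdealExponent`, `.sing`,
`.transform`, `IsPermissibleCentre`) enter as DEFINITIONS; no FACT-LIST premise is used. AI review is weaker than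
expert review.

## What is proved (strengthening p516034 / p517839's closer from `Terminates N Rd` to the GEOMETRIC statement)

* `CampaignW46.ForcedAtom.exists_presentation_transform_of_isBlowup` — the ONE STEP of p516034 restated for RAW blow-up
  data (a blow-up `π : Z′ → Z` of an ambient datum along the reduced ideal of a closed `D = {ξ}`, `ξ` the singular point,
  same base field), with no résumé and no centre rule: at every closed point `ξ′ ∈ Sing(E′)` of the transform, `J′_{ξ′}`
  is presented by a unit times the SUCCESSOR atom `z^p − ser (step i₀ t a)` of route `WildCones`' dynamics. Proof
  verbatim that of p516034 (bricks 1–13 of this seat's dictionary).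
* `CampaignW46.ForcedAtom.permissiblyTerminates_forcedAtom` — `K` algebraically closed of characteristic `p`, `0 < n`:
  **there is NO infinite §2.1-permissible sequence of blow-ups all of whose stages lie in `Regime.forcedAtom n`**
  (`PermissiblyTerminates`, res-L1-s46-pv-1): in the regime every permissible centre IS the singular point
  (irreducible, hence non-empty, inside a subsingleton `Sing`), the one step applies at every stage, and an infinite
  sequence would give an infinite isolated multiplicity-`p` run of the coefficient dynamics, excluded by
  `WildCones.IsolatedForcedTermination_proof`. By pv-1's `terminates_of_permissiblyTerminates` this RE-DERIVES o1's
  closer `forcedAtomTerminates_holds` for EVERY notion instance `N` and reading `Rd` (`forcedAtomTerminates_of_permissibly`)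
  — the résumés play no role in the forced-atom regime.

NOT claimed: `n = 0`; perfect non-closed `K`. References: this seat's p516034 (one step, induction), p517877/p519274/
p520554 (bricks 14/15, existential form), res-L1-s46-pv-1 p469934 (`PermissibleReduction`), res-L1-type-o1 p517839.
[cite: Matsumura1987, Thm. 8.11] (completions, as in p516034) [folklore]
-/

noncomputable section

-- single-problem summit: the doubled namespace component `ResolutionOfSingularities` is forced
set_option linter.dupNamespace false

open scoped BigOperators Classical
open MvPowerSeries IsLocalRing

namespace Summit.ResolutionOfSingularities.ResolutionOfSingularities.Theorems

namespace CampaignW46.ForcedAtom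

open CategoryTheory AlgebraicGeometry TopologicalSpace
open Literature.AlgebraicGeometry.Resolution
open Literature.AlgebraicGeometry.Hironaka2017.S02Preliminaries
open Literature.AlgebraicGeometry.Hironaka2017.Datum
open Scheme.IdealSheafData
open WildCones
open CampaignW46.ChartPoint CampaignW46.AtomGerm CampaignW46.FormalChart

variable {p : ℕ} [Fact p.Prime] {K : Type} [Field K] [CharP K p] [IsAlgClosed K] {n : ℕ}

/-! ## The one step, for raw blow-up data -/

/-- [OURS · L1 W4.6 — the ONE STEP in the forced-atom class for RAW blow-up data (no résumé, no centre rule); replaces the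
role of «the transform `E′` of `E` by the blowup with center `D`» (H. Hironaka, ms. 2017, Def. 2.1 p.5) at an isolated
`p`-fold point presented by a height-one atom; NOT a statement of the manuscript] Let `π : Z′ → Z` be the blow-up of an
ambient datum along the reduced ideal of the closed set `D = {ξ}`, over the same base field, `E = (J, p)` with
`Sing(E)` a subsingleton containing `ξ`, `𝒪_{Z,ξ}` of embedding dimension `n + 1`, and `(E₀, f₀, a, w)` a presentation of
`J_ξ` by a unit times the atom `z^p − ser a` with `MultP a`. Then at every CLOSED point `ξ′ ∈ Sing(E′)` of the transform,
`J′_{ξ′}` is presented by a unit times the successor atom `z^p − ser (step i₀ t a)`. [folklore] -/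
theorem exists_presentation_transform_of_isBlowup {A A' : AmbientDatum p K} (π : A'.Z ⟶ A.Z) (D : Closeds A.Z)
    (hπ : IsBlowup π (vanishingIdeal D)) (hhom : A'.hom = π ≫ A.hom) {E : IdealExponent A.Z} (hb : E.b = p)
    (hS : E.sing.Subsingleton)
    {ξ : A.Z} (hξ : ξ ∈ E.sing) (hD : (D : Set A.Z) = {ξ}) (hd : (maximalIdeal (A.Z.presheaf.stalk ξ)).spanFinrank = n + 1)
    (E₀ : AdicCompletion (maximalIdeal (A.Z.presheaf.stalk ξ)) (A.Z.presheaf.stalk ξ) ≃+*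
      MvPowerSeries (Option (Fin n)) K)
    (f₀ : A.Z.presheaf.stalk ξ) (a : (Fin n → ℕ) → K) (w : MvPowerSeries (Option (Fin n)) K)
    (hJ : stalkIdeal E.J ξ = Ideal.span {f₀}) (hw : IsUnit w)
    (hf₀ : E₀ (algebraMap _ _ f₀) =
      w * ((X none : MvPowerSeries (Option (Fin n)) K) ^ p - rename (some : Fin n → Option (Fin n)) (ser p n K a)))
    (hM : MultP p n K a)
    {ξ' : A'.Z} (hξ' : ξ' ∈ (E.transform π D).sing) (hξ'cl : IsClosed ({ξ'} : Set A'.Z)) :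
    ∃ (i₀ : Fin n) (t : Fin n → K)
      (E₀' : AdicCompletion (maximalIdeal (A'.Z.presheaf.stalk ξ')) (A'.Z.presheaf.stalk ξ') ≃+*
        MvPowerSeries (Option (Fin n)) K)
      (f₀' : A'.Z.presheaf.stalk ξ') (w' : MvPowerSeries (Option (Fin n)) K),
      stalkIdeal (E.transform π D).J ξ' = Ideal.span {f₀'} ∧ IsUnit w' ∧
        E₀' (algebraMap _ _ f₀') =
          w' * ((X none : MvPowerSeries (Option (Fin n)) K) ^ p -
            rename (some : Fin n → Option (Fin n)) (ser p n K (step p n K i₀ t a))) := by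
  haveI : IsLocallyNoetherian A'.Z := ambient_isLocallyNoetherian A'
  have hp : p.Prime := Fact.out
  -- the centre is the singular point, and `ξ′` lies over it
  have hDS : (D : Set A.Z) ⊆ E.sing := by
    rw [hD]
    exact Set.singleton_subset_iff.mpr hξ
  have hπξ : π ξ' = ξ := hS (sing_subset_of_transform hπ E hDS hξ') hξ
  subst hπξ
  haveI : IsRegularLocalRing (A.Z.presheaf.stalk (π ξ')) := ambient_isRegular A _
  haveI : IsRegularLocalRing (A'.Z.presheaf.stalk ξ') := ambient_isRegular A' _
  -- the local homomorphism `g = π^♯_{ξ′}`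
  have hloc : IsLocalHom (π.stalkMap ξ').hom := inferInstance
  have hg : (maximalIdeal (A.Z.presheaf.stalk (π ξ'))).map (π.stalkMap ξ').hom ≤
      maximalIdeal (A'.Z.presheaf.stalk ξ') :=
    ((IsLocalRing.local_hom_TFAE (π.stalkMap ξ').hom).out 0 2).mp hloc
  -- an adapted regular system of parameters at `π ξ′`
  obtain ⟨c, hc, hcX⟩ := exists_rsop_adapted E₀
  have hcl : IsClosed ({π ξ'} : Set A.Z) := hD ▸ D.isClosed
  have hcJ : Ideal.span (Set.range c) = stalkIdeal (vanishingIdeal D) (π ξ') := by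
    rw [hc, stalkIdeal_vanishingIdeal_eq_maximalIdeal_of_closure_eq]
    rw [hD, hcl.closure_eq]
  -- `ξ′` is rational relative to `π`
  haveI : LocallyOfFiniteType (π ≫ A.hom) := by
    rw [← hhom]
    haveI := A'.smooth
    infer_instance
  have hrat : ∀ y : A'.Z.presheaf.stalk ξ', ∃ r : A.Z.presheaf.stalk (π ξ'),
      y - (π.stalkMap ξ').hom r ∈ maximalIdeal (A'.Z.presheaf.stalk ξ') := fun y =>
    exists_sub_stalkMap_mem_maximalIdeal_of_isClosed π A.hom ξ' hξ'cl y
  -- chart data of the blow-up at `ξ′`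
  have hd' : (maximalIdeal (A.Z.presheaf.stalk (π ξ'))).spanFinrank = Fintype.card (Option (Fin n)) := by
    rw [hd, Fintype.card_option, Fintype.card_fin]
  obtain ⟨i, e, τ, he, hei, hnzd, hgen, -, hdim⟩ := exists_stalk_chartData_nzd hπ ξ' c hcJ hc hd' hrat
  -- `f₀ ∈ 𝔪^p`
  have hf₀𝔪 : f₀ ∈ maximalIdeal (A.Z.presheaf.stalk (π ξ')) ^ p := by
    have h := hξ
    change (E.b : ℕ∞) ≤ idealOrder E.J _ at h
    rw [le_idealOrder_iff, hJ, Ideal.span_singleton_le_iff_mem, hb] at h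
    exact h
  -- the conclusion from chart data with a `u`-index
  have tail : ∀ (i₀ : Fin n) (e : Option (Fin n) → A'.Z.presheaf.stalk ξ')
      (τ : Option (Fin n) → A.Z.presheaf.stalk (π ξ')),
      (∀ j, (π.stalkMap ξ').hom (c j) = (π.stalkMap ξ').hom (c (some i₀)) * e j) →
      (π.stalkMap ξ').hom (c (some i₀)) ∈ nonZeroDivisors (A'.Z.presheaf.stalk ξ') →
      Ideal.span (Set.range fun j : Option (Fin n) => if j = some i₀ then (π.stalkMap ξ').hom (c (some i₀))
        else e j - (π.stalkMap ξ').hom (τ j)) = maximalIdeal (A'.Z.presheaf.stalk ξ') →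
      ∃ (i₀ : Fin n) (t : Fin n → K)
        (E₀' : AdicCompletion (maximalIdeal (A'.Z.presheaf.stalk ξ')) (A'.Z.presheaf.stalk ξ') ≃+*
          MvPowerSeries (Option (Fin n)) K)
        (f₀' : A'.Z.presheaf.stalk ξ') (w' : MvPowerSeries (Option (Fin n)) K),
        stalkIdeal (E.transform π D).J ξ' = Ideal.span {f₀'} ∧ IsUnit w' ∧
          E₀' (algebraMap _ _ f₀') =
            w' * ((X none : MvPowerSeries (Option (Fin n)) K) ^ p -
              rename (some : Fin n → Option (Fin n)) (ser p n K (step p n K i₀ t a))) := by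
    intro i₀ e τ he hnzd hgen
    obtain ⟨f', hf'⟩ := exists_eq_pow_mul_of_mem_pow (π.stalkMap ξ').hom c hc (some i₀) e he hf₀𝔪
    have hJ' : stalkIdeal (E.transform π D).J ξ' = Ideal.span {f'} :=
      stalkIdeal_transform_eq_span hπ ξ' c hcJ (some i₀) e he hnzd E f₀ hJ f' (by rw [hb]; exact hf')
    have hf'𝔪 : f' ∈ maximalIdeal (A'.Z.presheaf.stalk ξ') := by
      have h := (mem_sing_transform_iff E ξ' f' hJ').mp hξ'
      rw [hb] at h
      exact Ideal.pow_le_self hp.ne_zero h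
    obtain ⟨E', w', hw', -, hE'⟩ := exists_ringEquiv_transform_atom (π.stalkMap ξ').hom hg E₀ c hc hcX i₀ e he τ
      hgen hrat hdim a hM f₀ w hw hf₀ f' hf' hf'𝔪
    exact ⟨i₀, _, E', f', w', hJ', hw', hE'⟩
  -- case on the chart index
  cases i with
  | some i₀ => exact tail i₀ e τ he hnzd hgen
  | none =>
    obtain ⟨f', hf'⟩ := exists_eq_pow_mul_of_mem_pow (π.stalkMap ξ').hom c hc none e he hf₀𝔪
    have hJ' : stalkIdeal (E.transform π D).J ξ' = Ideal.span {f'} :=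
      stalkIdeal_transform_eq_span hπ ξ' c hcJ none e he hnzd E f₀ hJ f' (by rw [hb]; exact hf')
    have hf'𝔪 : f' ∈ maximalIdeal (A'.Z.presheaf.stalk ξ') := by
      have h := (mem_sing_transform_iff E ξ' f' hJ').mp hξ'
      rw [hb] at h
      exact Ideal.pow_le_self hp.ne_zero h
    -- the `z`-chart point is not singular: some `τ̃_{j₀}` is a unit
    by_cases hτ : ∀ j : Fin n, τ (some j) ∈ maximalIdeal (A.Z.presheaf.stalk (π ξ'))
    · exact absurd hf'𝔪 (not_mem_maximalIdeal_transform_of_zChart (π.stalkMap ξ').hom hg E₀ c hc hcX e he τ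
        hgen hrat hdim hτ a hM f₀ w hw hf₀ f' hf')
    · simp only [not_forall] at hτ
      obtain ⟨j₀, hj₀⟩ := hτ
      have hu : IsUnit (τ (some j₀)) := (IsLocalRing.notMem_maximalIdeal).mp hj₀
      obtain ⟨e', τ', he', -, hgen'⟩ := exists_chartData_reindex (π.stalkMap ξ').hom c none e he hei τ hgen
        (some j₀) (Option.some_ne_none j₀) hu
      -- the new exceptional parameter is a non-zero-divisor: `g c_{j₀} = g c_none · e_{j₀}` with `e_{j₀}` a unit
      have hej₀ : IsUnit (e (some j₀)) := by
        refine isUnit_of_sub_mem_maximalIdeal (hu.map (π.stalkMap ξ').hom) ?_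
        rw [← hgen]
        exact Ideal.subset_span ⟨some j₀, by dsimp only; rw [if_neg (Option.some_ne_none j₀)]⟩
      have hnzd' : (π.stalkMap ξ').hom (c (some j₀)) ∈ nonZeroDivisors (A'.Z.presheaf.stalk ξ') := by
        rw [he (some j₀)]
        exact mul_mem hnzd hej₀.mem_nonZeroDivisors
      exact tail j₀ e' τ' he' hnzd' hgen'


/-! ## No infinite permissible sequence in the forced-atom regime -/

/-- [OURS · L1 W4.6, rung (i) for surfaces (`n = 1`), (ii)-type for all `n ≥ 1` — RÉSUMÉ-FREE; replaces the role of the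
termination clause of Th. 16.13 p.87 l.25–28 («by applying Th.(16.6) … repeatedly but finitely many times») of
H. Hironaka's ms. (2017) read on §2.1-PERMISSIBLE SEQUENCES restricted to the forced-atom regime; NOT a statement of the
manuscript] **Over an algebraically closed field of characteristic `p`, `0 < n`, there is no infinite §2.1-permissible
sequence of blow-ups all of whose stages lie in `Regime.forcedAtom n`.** [folklore] -/
theorem permissiblyTerminates_forcedAtom (hn : 0 < n) :
    PermissiblyTerminates (Regime.forcedAtom (p := p) (K := K) n) := by
  intro r hr
  have hp : p.Prime := Fact.out
  have hS : ∀ k, (r.E k).sing.Subsingleton := fun k => (hr k).2.1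
  -- in the regime every permissible centre is the singular point
  have hcen : ∀ k, ∃ ξ : (r.A k).Z, (r.D k : Set (r.A k).Z) = {ξ} ∧ (r.E k).sing = {ξ} := by
    intro k
    obtain ⟨ξ, hξD⟩ := (r.permissible k).irreducible.nonempty
    have hξS : ξ ∈ (r.E k).sing := (r.permissible k).subset_sing hξD
    refine ⟨ξ, ?_, (hS k).eq_singleton_of_mem hξS⟩
    exact (Set.subsingleton_of_subset_singleton
      (((hS k).eq_singleton_of_mem hξS) ▸ (r.permissible k).subset_sing)).eq_singleton_of_mem hξD
  choose ξ hξ using hcen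
  have hξS : ∀ k, ξ k ∈ (r.E k).sing := fun k => by
    rw [(hξ k).2]
    exact Set.mem_singleton _
  have hcl : ∀ k, IsClosed ({ξ k} : Set (r.A k).Z) := fun k => by
    rw [← (hξ k).1]
    exact (r.D k).isClosed
  -- multiplicity `p` of a presented atom is read off `ξ_k ∈ Sing(E_k)` (and `ser ≠ 0` off isolatedness)
  have hmult : ∀ (k : ℕ)
      (E₀ : AdicCompletion (maximalIdeal ((r.A k).Z.presheaf.stalk (ξ k))) ((r.A k).Z.presheaf.stalk (ξ k)) ≃+*
        MvPowerSeries (Option (Fin n)) K)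
      (f₀ : (r.A k).Z.presheaf.stalk (ξ k)) (a : (Fin n → ℕ) → K) (w : MvPowerSeries (Option (Fin n)) K),
      stalkIdeal (r.E k).J (ξ k) = Ideal.span {f₀} → IsUnit w →
        E₀ (algebraMap _ _ f₀) = w * ((X none : MvPowerSeries (Option (Fin n)) K) ^ p -
          rename (some : Fin n → Option (Fin n)) (ser p n K a)) → MultP p n K a := by
    intro k E₀ f₀ a w hJ hw hf₀
    haveI : IsRegularLocalRing ((r.A k).Z.presheaf.stalk (ξ k)) := ambient_isRegular (r.A k) _
    have hI : Isol p n K a := ((hr k).2.2 (ξ k) (hξS k)).2.2 E₀ f₀ a w hJ hw hf₀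
    have hf₀𝔪 : f₀ ∈ maximalIdeal ((r.A k).Z.presheaf.stalk (ξ k)) ^ p := by
      have h := hξS k
      change ((r.E k).b : ℕ∞) ≤ idealOrder (r.E k).J _ at h
      rw [le_idealOrder_iff, hJ, Ideal.span_singleton_le_iff_mem, (hr k).1] at h
      exact h
    exact (transform_mem_pow_iff_multP E₀ hw a hf₀).2.mpr ⟨ThreefoldsCharTwo.ser_ne_zero_of_isol hn hI, hf₀𝔪⟩
  -- presentations at `ξ_k`, and the one-step transition
  let P : ℕ → Type := fun k =>
    Σ' (E₀ : AdicCompletion (maximalIdeal ((r.A k).Z.presheaf.stalk (ξ k))) ((r.A k).Z.presheaf.stalk (ξ k)) ≃+*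
        MvPowerSeries (Option (Fin n)) K)
      (f₀ : (r.A k).Z.presheaf.stalk (ξ k)) (a : (Fin n → ℕ) → K) (w : MvPowerSeries (Option (Fin n)) K),
      stalkIdeal (r.E k).J (ξ k) = Ideal.span {f₀} ∧ IsUnit w ∧
        E₀ (algebraMap _ _ f₀) = w * ((X none : MvPowerSeries (Option (Fin n)) K) ^ p -
          rename (some : Fin n → Option (Fin n)) (ser p n K a))
  have hnext : ∀ (k : ℕ) (q : P k), ∃ (i₀ : Fin n) (t : Fin n → K) (q' : P (k + 1)),
      q'.2.2.1 = step p n K i₀ t q.2.2.1 := by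
    intro k q
    obtain ⟨E₀, f₀, a, w, hJ, hw, hf₀⟩ := q
    have hd := ((hr k).2.2 (ξ k) (hξS k)).1
    have hξ' : ξ (k + 1) ∈ ((r.E k).transform (r.π k) (r.D k)).sing := by
      rw [← r.E_succ k]
      exact hξS (k + 1)
    obtain ⟨i₀, t, E₀', f₀', w', hJ', hw', hf₀'⟩ := exists_presentation_transform_of_isBlowup (r.π k) (r.D k)
      (r.blowup k) (r.hom_eq k) (hr k).1 (hS k) (hξS k) (hξ k).1 hd E₀ f₀ a w hJ hw hf₀
      (hmult k E₀ f₀ a w hJ hw hf₀) hξ' (hcl (k + 1))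
    refine ⟨i₀, t, ⟨E₀', f₀', step p n K i₀ t a, w', ?_, hw', hf₀'⟩, rfl⟩
    rw [r.E_succ k]
    exact hJ'
  choose inext tnext qnext hnext using hnext
  -- the initial presentation and the induced sequence of presentations
  obtain ⟨E₀, f₀, c₀, w₀, hJ0, hw0, hf0⟩ := ((hr 0).2.2 (ξ 0) (hξS 0)).2.1
  let q0 : P 0 := ⟨E₀, f₀, c₀, w₀, hJ0, hw0, hf0⟩
  let sq : ∀ k, P k := fun k => Nat.rec (motive := fun k => P k) q0 (fun k q => qnext k q) k
  have hsq : ∀ k, sq (k + 1) = qnext k (sq k) := fun k => rfl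
  -- the induced run of the coefficient calculus
  have hrun : ∀ k, run p n K c₀ (fun k => inext k (sq k)) (fun k => tnext k (sq k)) k = (sq k).2.2.1 := by
    intro k
    induction k with
    | zero => rfl
    | succ k ih =>
      rw [hsq, hnext k (sq k), ← ih]
      rfl
  -- every state is isolated of multiplicity `p`: contradiction with the proved target of `WildCones`
  have hnot : ¬ InfRun p n K c₀ (fun k => inext k (sq k)) (fun k => tnext k (sq k)) :=
    IsolatedForcedTermination_proof p hp n hn K c₀ _ _
  refine hnot fun k => ?_
  rw [hrun k]
  obtain ⟨E₀, f₀, a, w, hJ, hw, hf₀⟩ := sq k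
  exact ⟨((hr k).2.2 (ξ k) (hξS k)).2.2 E₀ f₀ a w hJ hw hf₀, hmult k E₀ f₀ a w hJ hw hf₀⟩

/-- [OURS · L1 W4.6; NOT a statement of the manuscript] The résumé-free theorem RE-DERIVES the typed rung for EVERY notion
instance and reading (res-L1-s46-pv-1's `terminates_of_permissiblyTerminates`): `ForcedAtomTerminates p K n` (o1,
p517839) over an algebraically closed `K`, `0 < n`. [folklore] -/
theorem forcedAtomTerminates_of_permissibly (hn : 0 < n) : ForcedAtomTerminates p K n :=
  fun _ N Rd => terminates_of_permissiblyTerminates N Rd (permissiblyTerminates_forcedAtom hn)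

/-- [OURS · L1 W4.6; NOT a statement of the manuscript] The same in the EXISTENTIAL form of the regime: every regime
contained in the existential forced-atom class (SOME presentation by an isolated atom) has no infinite §2.1-permissible
sequence (`K` algebraically closed, `0 < n`). [folklore] -/
theorem permissiblyTerminates_of_le_forcedAtomExists (hn : 0 < n) (Rg : Regime p K)
    (hRg : ∀ (A : AmbientDatum p K) (E : IdealExponent A.Z), Rg A E →
      E.b = p ∧ E.sing.Subsingleton ∧ ∀ ξ ∈ E.sing,
        (maximalIdeal (A.Z.presheaf.stalk ξ)).spanFinrank = n + 1 ∧
        ∃ (E₀ : AdicCompletion (maximalIdeal (A.Z.presheaf.stalk ξ)) (A.Z.presheaf.stalk ξ) ≃+*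
            MvPowerSeries (Option (Fin n)) K)
          (f₀ : A.Z.presheaf.stalk ξ) (c₀ : (Fin n → ℕ) → K) (w₀ : MvPowerSeries (Option (Fin n)) K),
          stalkIdeal E.J ξ = Ideal.span {f₀} ∧ IsUnit w₀ ∧
            E₀ (algebraMap _ _ f₀) = w₀ * ((X none : MvPowerSeries (Option (Fin n)) K) ^ p -
              rename (some : Fin n → Option (Fin n)) (ser p n K c₀)) ∧ Isol p n K c₀) :
    PermissiblyTerminates Rg :=
  haveI : PerfectRing K p := PerfectField.toPerfectRing p
  fun r hr => permissiblyTerminates_forcedAtom hn r fun k => Regime.forcedAtom_of_exists _ _ (hRg _ _ (hr k))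

end CampaignW46.ForcedAtom

end Summit.ResolutionOfSingularities.ResolutionOfSingularities.Theorems

end
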